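import Literature.NumberTheory.Sieve.FouvryTenenbaumDivisorAPLemma413DeligneBB
import Literature.NumberTheory.LFunctions.KloostermanWeilPrimeProofs
import HarnessLib

/-!
# The two Deligne-level inputs of Heath-Brown 1986 in normal form

Source: D. R. Heath-Brown, *The divisor function `d₃(n)` in arithmetic progressions*, Acta Arith. 47
(1986) 29–56, §3 [cite: HeathBrown1986d3]; B. J. Birch, E. Bombieri, Appendix to J. B. Friedlander,
H. Iwaniec, *Incomplete Kloosterman sums and a divisor problem*, Ann. of Math. 121 (1985) 319–350
[cite: FriedlanderIwaniec1985].

`FouvryTenenbaum2021_lemma413_of_deligne_birchBombieri` (file `FouvryTenenbaumDivisorAPLemma413DeligneBB`)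
reduces Fouvry–Tenenbaum's Lemma 4.13 to exactly two inputs, both consequences of Deligne's theorem:
`hD`, the bound `|K₂(a₁, a₂, a₃; p)| ≤ 3p` (`p ∤ a₁a₂a₃`), and `hBB`, the Birch–Bombieri bound
`|S'(α, β; p)| ≤ C p^{3/2}` (`p ∤ αβ`).  This file puts both inputs in their standard one-parameter
forms and proves what Weil's bound alone gives for the second (theorems only; no named facts):

* `K2_eq_K2_one_one` — `K₂(a₁, a₂, a₃; p) = K₂(1, 1, a₁a₂a₃; p) = Kl₃(a₁a₂a₃; p)`
  (`= ∑_{xyz = a₁a₂a₃} e_p(x + y + z)`), so `hD` is Deligne's `|Kl₃(a; p)| ≤ 3p`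
  (`deligne_K2_iff_one_one`);
* `BBsum_eq_sum_kloosterman` — **the Birch–Bombieri sum is a correlation sum of two Kloosterman
  sums along the Möbius transformation `u ↦ βu/(u − α)`**:
  `S'(α, β; p) = ∑_{u ≢ 0, α} S(1, u; p) · S(1, βu/(u − α); p)`
  (substitute `u = xy`, `U = XY`; the constraint `α/u + β/U = 1` forces `u ≠ α`, `U = βu/(u − α)`);
* `norm_BBsum_le_weil` — hence, by Weil's bound `|S(1, u; p)| ≤ 2√p` (PROVED in the tree,
  `weil_kloosterman_bound_prime_holds`), `|S'(α, β; p)| ≤ 4p(p − 2)` unconditionally.  The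
  Birch–Bombieri theorem `|S'| ≤ C p^{3/2}` is square-root cancellation in the remaining variable
  `u`, i.e. the non-correlation of the Kloosterman sheaf with its pull-back by a non-identity
  element of `PGL₂(𝔽_p)` — Deligne's theorem (Weil II) on a curve; it is not proved here.
-/

open Finset

namespace Literature.NumberTheory.Sieve.HeathBrown1986

open Literature.NumberTheory.LFunctions (kloostermanSum weil_kloosterman_bound_prime_holds
  norm_kloostermanSum_le)

section NormalForms

variable {p : ℕ} [hp : Fact p.Prime]

/-! ### `hD` in one-parameter form -/

/-- `K₂(a₁, a₂, a₃; q) = K₂(1, 1, a₁a₂a₃; q)` for units `a₁, a₂` (substitute `x ↦ ā₁x`,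
`y ↦ ā₂y`); the right-hand side is `Kl₃(a₁a₂a₃; q) = ∑*_{x,y} e_q(x + y + a₁a₂a₃ x̄ȳ)`.
[cite: HeathBrown1986d3, §3 (3.1)] -/
theorem K2_eq_K2_one_one {q : ℕ} [NeZero q] {a₁ a₂ : ZMod q} (h₁ : IsUnit a₁) (h₂ : IsUnit a₂)
    (a₃ : ZMod q) : K2 q a₁ a₂ a₃ = K2 q 1 1 (a₁ * a₂ * a₃) := by
  rw [← K2_scale_units h₁ h₂ 1 1 a₃, one_mul, one_mul]

/-- Deligne's prime bound for `K₂` in Heath-Brown's three-parameter form is equivalent to its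
one-parameter form `|Kl₃(a; p)| ≤ 3p` (`a ≢ 0`). [cite: HeathBrown1986d3, §3 (3.1)] -/
theorem deligne_K2_iff_one_one :
    (∀ a₁ a₂ a₃ : ZMod p, a₁ ≠ 0 → a₂ ≠ 0 → a₃ ≠ 0 → ‖K2 p a₁ a₂ a₃‖ ≤ 3 * p) ↔
      (∀ a : ZMod p, a ≠ 0 → ‖K2 p 1 1 a‖ ≤ 3 * p) := by
  constructor
  · intro h a ha
    exact h 1 1 a one_ne_zero one_ne_zero ha
  · intro h a₁ a₂ a₃ h₁ h₂ h₃
    rw [K2_eq_K2_one_one (isUnit_iff_ne_zero.mpr h₁) (isUnit_iff_ne_zero.mpr h₂)]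
    exact h _ (mul_ne_zero (mul_ne_zero h₁ h₂) h₃)

/-! ### `hBB`: the Birch–Bombieri sum as a Kloosterman correlation sum -/

/-- Reindexing `y = x̄u` in a double sum over pairs of units. [folklore] -/
theorem sum_isUnit_pair_reindex {M : Type*} [AddCommMonoid M] (f : ZMod p → ZMod p → M) :
    ∑ x : ZMod p, ∑ y : ZMod p, (if IsUnit x ∧ IsUnit y then f x y else 0) =
      ∑ u : ZMod p, ∑ x : ZMod p, (if IsUnit x ∧ IsUnit u then f x (x⁻¹ * u) else 0) := by
  classical
  rw [Finset.sum_comm (f := fun (u : ZMod p) (x : ZMod p) =>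
    (if IsUnit x ∧ IsUnit u then f x (x⁻¹ * u) else 0))]
  refine Finset.sum_congr rfl fun x _ => ?_
  by_cases hx : IsUnit x
  · have hx0 : x ≠ 0 := hx.ne_zero
    conv_rhs => rw [← Equiv.sum_comp (Equiv.mulLeft₀ x hx0)]
    refine Finset.sum_congr rfl fun y _ => ?_
    simp only [Equiv.mulLeft₀_apply, IsUnit.mul_iff, hx, true_and, inv_mul_cancel_left₀ hx0]
  · have h0 : ∀ y : ZMod p, ¬ (IsUnit x ∧ IsUnit y) := fun y h => hx h.1
    simp only [h0, if_false, Finset.sum_const_zero]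

/-- For a unit `X`: `X̄ · (X̄U)⁻¹ = Ū`. [folklore] -/
theorem inv_mul_inv_inv_mul {X : ZMod p} (hX : X ≠ 0) (U : ZMod p) :
    X⁻¹ * (X⁻¹ * U)⁻¹ = U⁻¹ := by
  rw [mul_inv_rev, inv_inv, mul_comm U⁻¹ X, inv_mul_cancel_left₀ hX]

/-- The constraint `c + β Ū = 1` (`β ≢ 0`) has the unique unit solution `U = β/(1 − c)` when
`c ≠ 1` and none when `c = 1`. [folklore] -/
theorem sum_isUnit_constraint_eq {β : ZMod p} (hβ : β ≠ 0) (c : ZMod p) (g : ZMod p → ℂ) :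
    ∑ U : ZMod p, (if IsUnit U ∧ c + β * U⁻¹ = 1 then g U else 0) =
      if c ≠ 1 then g (β * (1 - c)⁻¹) else 0 := by
  classical
  by_cases hc : c = 1
  · rw [if_neg (not_not.mpr hc)]
    refine Finset.sum_eq_zero fun U _ => ?_
    rw [if_neg]
    rintro ⟨hU, hcU⟩
    rw [hc] at hcU
    have h0 : β * U⁻¹ = 0 := by linear_combination hcU
    rw [mul_eq_zero] at h0
    rcases h0 with h | h
    · exact hβ h
    · exact hU.ne_zero (inv_eq_zero.mp h)
  · rw [if_pos hc]
    have hd : (1 - c) ≠ 0 := sub_ne_zero.mpr (Ne.symm hc)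
    have key : ∀ U : ZMod p, (IsUnit U ∧ c + β * U⁻¹ = 1) ↔ U = β * (1 - c)⁻¹ := by
      intro U
      constructor
      · rintro ⟨hU, hcU⟩
        have hU0 : U ≠ 0 := hU.ne_zero
        have e1 : β * U⁻¹ = 1 - c := by linear_combination hcU
        have e2 : β = (1 - c) * U := by
          have := congrArg (· * U) e1
          simpa only [mul_assoc, inv_mul_cancel₀ hU0, mul_one] using this
        rw [e2, mul_comm (1 - c) U, mul_assoc, mul_inv_cancel₀ hd, mul_one]
      · rintro rfl
        refine ⟨isUnit_iff_ne_zero.mpr (mul_ne_zero hβ (inv_ne_zero hd)), ?_⟩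
        rw [mul_inv_rev, inv_inv, mul_comm (1 - c) β⁻¹, ← mul_assoc, mul_inv_cancel₀ hβ, one_mul,
          add_sub_cancel]
    simp_rw [key]
    rw [Finset.sum_ite_eq' Finset.univ (β * (1 - c)⁻¹) g, if_pos (Finset.mem_univ _)]

omit hp in
/-- Unfolding the Kloosterman sum `S(1, u; q) = ∑*_x e_q(x + u x̄)`. [folklore] -/
theorem kloostermanSum_one_left {q : ℕ} [NeZero q] (u : ZMod q) :
    kloostermanSum q 1 u =
      by classical exact ∑ x : ZMod q, if IsUnit x then (ZMod.stdAddChar (x + x⁻¹ * u) : ℂ) else 0 := by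
  classical
  unfold kloostermanSum
  refine Finset.sum_congr rfl fun x _ => ?_
  rw [one_mul, mul_comm u]

/-- For a unit `u`: `α ū ≠ 1 ↔ u ≠ α`, and `(1 − α ū)⁻¹ = u/(u − α)`. [folklore] -/
theorem one_sub_mul_inv_inv {u : ZMod p} (hu : u ≠ 0) (α : ZMod p) :
    (α * u⁻¹ ≠ 1 ↔ u ≠ α) ∧ (1 - α * u⁻¹)⁻¹ = u * (u - α)⁻¹ := by
  have e : 1 - α * u⁻¹ = (u - α) * u⁻¹ := by
    rw [sub_mul, mul_inv_cancel₀ hu]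
  refine ⟨?_, ?_⟩
  · rw [not_iff_not]
    constructor
    · intro h
      have := congrArg (· * u) h
      simp only [mul_assoc, inv_mul_cancel₀ hu, mul_one, one_mul] at this
      exact this.symm
    · rintro rfl
      exact mul_inv_cancel₀ hu
  · rw [e, mul_inv_rev, inv_inv]

/-- **The Birch–Bombieri sum is a Kloosterman correlation sum**: for `α, β ≢ 0 (mod p)`,
`S'(α, β; p) = ∑_{u ≢ 0, α} S(1, u; p) · S(1, βu/(u − α); p)`.
(Substitute `u = xy`, `U = XY` in `S' = ∑*_{α x̄ȳ + β X̄Ȳ ≡ 1} e_p(x + y + X + Y)`: the `x`- and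
`X`-sums become `S(1, u; p)` and `S(1, U; p)`, and the constraint reads `U = βu/(u − α)`, `u ≠ α`.)
[cite: HeathBrown1986d3, §3 p.37] [cite: FriedlanderIwaniec1985, Appendix] -/
theorem BBsum_eq_sum_kloosterman {α β : ZMod p} (hβ : β ≠ 0) :
    BBsum p α β = ∑ u : ZMod p,
      if u ≠ 0 ∧ u ≠ α then kloostermanSum p 1 u * kloostermanSum p 1 (β * u * (u - α)⁻¹) else 0 := by
  classical
  -- Step 1: separate the unit conditions and the character.
  have h1 : BBsum p α β = ∑ x : ZMod p, ∑ y : ZMod p, (if IsUnit x ∧ IsUnit y then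
      (ZMod.stdAddChar (x + y) : ℂ) * ∑ X : ZMod p, ∑ Y : ZMod p, (if IsUnit X ∧ IsUnit Y then
        (if α * (x⁻¹ * y⁻¹) + β * (X⁻¹ * Y⁻¹) = 1 then (ZMod.stdAddChar (X + Y) : ℂ) else 0)
        else 0) else 0) := by
    rw [BBsum_def]
    refine Finset.sum_congr rfl fun x _ => Finset.sum_congr rfl fun y _ => ?_
    by_cases hxy : IsUnit x ∧ IsUnit y
    · rw [if_pos hxy, Finset.mul_sum]
      refine Finset.sum_congr rfl fun X _ => ?_
      rw [Finset.mul_sum]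
      refine Finset.sum_congr rfl fun Y _ => ?_
      by_cases hXY : IsUnit X ∧ IsUnit Y
      · rw [if_pos hXY]
        by_cases hc : α * (x⁻¹ * y⁻¹) + β * (X⁻¹ * Y⁻¹) = 1
        · rw [if_pos ⟨hxy, hXY, hc⟩, if_pos hc, ← AddChar.map_add_eq_mul,
            show x + y + (X + Y) = x + y + X + Y from (add_assoc _ _ _).symm]
        · rw [if_neg (fun h => hc h.2.2), if_neg hc, mul_zero]
      · rw [if_neg (fun h => hXY h.2.1), if_neg hXY, mul_zero]
    · rw [if_neg hxy]
      exact Finset.sum_eq_zero fun X _ => Finset.sum_eq_zero fun Y _ => if_neg fun h => hxy h.1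
  -- Step 2: the inner double sum, for fixed `c = α x̄ȳ`.
  have h2 : ∀ c : ZMod p, ∑ X : ZMod p, ∑ Y : ZMod p, (if IsUnit X ∧ IsUnit Y then
      (if c + β * (X⁻¹ * Y⁻¹) = 1 then (ZMod.stdAddChar (X + Y) : ℂ) else 0) else 0) =
      if c ≠ 1 then kloostermanSum p 1 (β * (1 - c)⁻¹) else 0 := by
    intro c
    rw [sum_isUnit_pair_reindex]
    have h2a : ∀ U : ZMod p, ∑ X : ZMod p, (if IsUnit X ∧ IsUnit U then
        (if c + β * (X⁻¹ * (X⁻¹ * U)⁻¹) = 1 then (ZMod.stdAddChar (X + X⁻¹ * U) : ℂ) else 0) else 0) =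
        if IsUnit U ∧ c + β * U⁻¹ = 1 then kloostermanSum p 1 U else 0 := by
      intro U
      rw [kloostermanSum_one_left]
      by_cases hU : IsUnit U ∧ c + β * U⁻¹ = 1
      · rw [if_pos hU]
        refine Finset.sum_congr rfl fun X _ => ?_
        by_cases hX : IsUnit X
        · rw [if_pos ⟨hX, hU.1⟩, inv_mul_inv_inv_mul hX.ne_zero, if_pos hU.2, if_pos hX]
        · rw [if_neg (fun h => hX h.1), if_neg hX]
      · rw [if_neg hU]
        refine Finset.sum_eq_zero fun X _ => ?_
        by_cases hX : IsUnit X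
        · by_cases hU' : IsUnit U
          · rw [if_pos ⟨hX, hU'⟩, inv_mul_inv_inv_mul hX.ne_zero, if_neg (fun h => hU ⟨hU', h⟩)]
          · rw [if_neg (fun h => hU' h.2)]
        · rw [if_neg (fun h => hX h.1)]
    simp_rw [h2a]
    exact sum_isUnit_constraint_eq hβ c _
  simp_rw [h2] at h1
  rw [h1, sum_isUnit_pair_reindex]
  refine Finset.sum_congr rfl fun u _ => ?_
  -- Step 3: the outer sum for fixed `u = xy`.
  by_cases hu : u ≠ 0 ∧ u ≠ α
  · obtain ⟨hu0, huα⟩ := hu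
    have hU : IsUnit u := isUnit_iff_ne_zero.mpr hu0
    obtain ⟨hiff, hinv⟩ := one_sub_mul_inv_inv hu0 α
    rw [if_pos ⟨hu0, huα⟩, kloostermanSum_one_left u, Finset.sum_mul]
    refine Finset.sum_congr rfl fun x _ => ?_
    by_cases hx : IsUnit x
    · rw [if_pos ⟨hx, hU⟩, if_pos hx, inv_mul_inv_inv_mul hx.ne_zero, if_pos (hiff.mpr huα), hinv,
        ← mul_assoc]
    · rw [if_neg (fun h => hx h.1), if_neg hx, zero_mul]
  · rw [if_neg hu]
    refine Finset.sum_eq_zero fun x _ => ?_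
    by_cases hx : IsUnit x
    · by_cases hu0 : u = 0
      · rw [if_neg]; rintro ⟨-, hU⟩; exact hU.ne_zero hu0
      · have huα : u = α := by
          by_contra h; exact hu ⟨hu0, h⟩
        rw [if_pos ⟨hx, isUnit_iff_ne_zero.mpr hu0⟩, inv_mul_inv_inv_mul hx.ne_zero, if_neg, mul_zero]
        exact fun h => ((one_sub_mul_inv_inv hu0 α).1.mp h) huα
    · rw [if_neg (fun h => hx h.1)]

/-- **What Weil's bound gives for the Birch–Bombieri sum**: `|S'(α, β; p)| ≤ 4p(p − 2)` for
`α, β ≢ 0 (mod p)` — each of the `p − 2` terms of `BBsum_eq_sum_kloosterman` is a product of two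
complete Kloosterman sums with unit parameters, each at most `2√p` (`weil_kloosterman_bound_prime_holds`).
The Birch–Bombieri theorem improves this to `C p^{3/2}` (Deligne). [cite: HeathBrown1986d3, §3 p.37] -/
theorem norm_BBsum_le_weil {α β : ZMod p} (hα : α ≠ 0) (hβ : β ≠ 0) :
    ‖BBsum p α β‖ ≤ 4 * p * ((p : ℝ) - 2) := by
  classical
  rw [BBsum_eq_sum_kloosterman hβ]
  have hp0 : (0 : ℝ) ≤ p := Nat.cast_nonneg _
  have hterm : ∀ u : ZMod p, ‖(if u ≠ 0 ∧ u ≠ α then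
      kloostermanSum p 1 u * kloostermanSum p 1 (β * u * (u - α)⁻¹) else 0)‖ ≤
      if u ≠ 0 ∧ u ≠ α then 4 * (p : ℝ) else 0 := by
    intro u
    split_ifs with hu
    · rw [norm_mul]
      have hv : β * u * (u - α)⁻¹ ≠ 0 :=
        mul_ne_zero (mul_ne_zero hβ hu.1) (inv_ne_zero (sub_ne_zero.mpr hu.2))
      have b1 := weil_kloosterman_bound_prime_holds p 1 u one_ne_zero hu.1
      have b2 := weil_kloosterman_bound_prime_holds p 1 _ one_ne_zero hv
      calc ‖kloostermanSum p 1 u‖ * ‖kloostermanSum p 1 (β * u * (u - α)⁻¹)‖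
          ≤ (2 * Real.sqrt p) * (2 * Real.sqrt p) :=
            mul_le_mul b1 b2 (norm_nonneg _) (by positivity)
        _ = 4 * p := by
            rw [mul_mul_mul_comm, Real.mul_self_sqrt hp0]; norm_num
    · rw [norm_zero]
  refine (norm_sum_le _ _).trans ((Finset.sum_le_sum fun u _ => hterm u).trans ?_)
  rw [← Finset.sum_filter, Finset.sum_const, nsmul_eq_mul]
  have hcard : ((Finset.univ.filter fun u : ZMod p => u ≠ 0 ∧ u ≠ α).card : ℝ) = (p : ℝ) - 2 := by
    have hset : (Finset.univ.filter fun u : ZMod p => u ≠ 0 ∧ u ≠ α) =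
        (Finset.univ.erase (0 : ZMod p)).erase α := by
      ext u; simp [and_comm]
    rw [hset, Finset.card_erase_of_mem, Finset.card_erase_of_mem (Finset.mem_univ _),
      Finset.card_univ, ZMod.card]
    · have h2 : 2 ≤ p := hp.out.two_le
      push_cast [Nat.sub_sub, h2]
      ring
    · exact Finset.mem_erase.mpr ⟨hα, Finset.mem_univ _⟩
  rw [hcard]
  nlinarith [hp0]

end NormalForms

end Literature.NumberTheory.Sieve.HeathBrown1986
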